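import Summits.QuantumFields.YangMills.Theorems.AlphaInputsT3ACBridge
import Summits.QuantumFields.Balaban3D.Proofs.TowerFactsAC
import HarnessLib

/-!
# `AlphaInputsT3AC` — T³ READINGS of the AC tower's objects for the Literature interface `T3AlphaInputsAC` (bridge support): the main term of
# (41)/(47) at the T³ scales IS the route's `β_K · Σ_p[1 − Re tr U_k(h,W)(∂p)]` (the interface's `MainTermIsAction` shape, with
# `Umin := U_k(·,h)`), for ANY AC inputs over `T3Scales` — lane `pub-balaban3d`, seat alpha-1 (LINE 2 of `defn-AlphaInputsT3AC`)

`TowerFactsAC.mainT_towerOfAC_eq` (`mainT = (1/g₀²)·A₄(U_k(h,W))`, normalisation `(1/g_k²)·η^{−1} = 1/(g²ε)`) + `T3Scales_inv_g0sq_eq`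
(`1/g₀² = β_K`).  [folklore] bookkeeping; nothing of [Balaban1985UV3] is asserted.
-/

set_option autoImplicit false

noncomputable section

namespace Summit.QuantumFields.YangMills.Theorems

open MeasureTheory
open scoped BigOperators
open Literature.MathematicalPhysics.QuantumFieldTheory.Balaban1983to89
open Literature.MathematicalPhysics.QuantumFieldTheory.Balaban1983to89.T3ContinuumYM3Torus
open Literature.MathematicalPhysics.QuantumFieldTheory.Balaban1983to89.T3UnitLawDensityEML (ℰp)
open Literature.MathematicalPhysics.QuantumFieldTheory.Balaban1985CMP102
open Literature.MathematicalPhysics.QuantumFieldTheory.Balaban1985CMP102.Setting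
open Summit.QuantumFields.Balaban3D.Carriers
open Summit.QuantumFields.Balaban3D.Proofs.Inputs (LaneConsts)
open Summit.QuantumFields.Balaban3D.Proofs.Primitives
open Summit.QuantumFields.Balaban3D.Proofs.StandardAC
open Summit.QuantumFields.Balaban3D.Proofs.InputsAC
open Summit.QuantumFields.Balaban3D.Proofs.TowerFactsAC

variable {F : T3Family} {γ : ℝ} {hγ : 0 < γ} {hγ1 : γ ≤ 1} {K : ℕ}

/-- **THE MAIN TERM AT THE T³ SCALES IS `β_K · A₄(U_k(h,W))`** — the interface's `MainTermIsAction` shape for the AC tower of ANY AC inputs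
`X` over `T3Scales F γ … K` (composite minimiser `Umin := X.UkH`): `(1/g_k²)A^η(U_k(h,W)) = (1/g₀²)·Σ_p[1 − Re tr U_k(h,W)(∂p)]`
(`TowerFactsAC.mainT_towerOfAC_eq`) and `1/g₀² = β_K` (`T3Scales_inv_g0sq_eq`). [cite: Balaban1985UV3, (5) p.256 + (41) p.266] -/
theorem mainT_towerOfAC_T3_eq (K₀ : LaneConsts F.L) {V : Type} [NormedAddCommGroup V] [NormedSpace ℂ V]
    (X : ExternalInputsAC (T3Scales F γ hγ hγ1 K) (Matrix.specialUnitaryGroup (Fin 2) ℂ))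
    (𝔖 : ∀ k, StepSeries (T3Scales F γ hγ hγ1 K) (Matrix.specialUnitaryGroup (Fin 2) ℂ) V (nblkOf (T3Scales F γ hγ hγ1 K) K₀.carrier k) k)
    (j : ℕ) (h : Hist (F.P K) j) (W : GaugeField (F.P K) j (Matrix.specialUnitaryGroup (Fin 2) ℂ)) :
    (towerOfAC K₀ X 𝔖).mainT j h W = (F.scheme ℰp γ).β K * wilsonAction4 (X.UkH j h W) := by
  rw [← T3Scales_inv_g0sq_eq F γ hγ hγ1 K]
  exact mainT_towerOfAC_eq K₀ X 𝔖 j h W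

/-- **THE SAME FOR THE PACKAGE'S TOWER** (`AlphaInputsT3ACBridge.PkgAt`): `mainT_j(h, W) = β_K · A₄(U_j(h, W))` with the package's composite
minimiser — the interface's `MainTermIsAction` for the successor's `D_of` (`Umin := p.UkH`) by `exact`. [cite: Balaban1985UV3, (5) p.256 + (41) p.266] -/
theorem AlphaInputsT3AC.PkgAt.mainT_eq {𝔠 : AlphaConsts F.L (suGroupModel 2).N} {hγ1' : γ ≤ (min 𝔠.gamma0 1) ^ 2}
    (p : AlphaInputsT3AC.PkgAt F 𝔠 γ hγ hγ1' K) (j : ℕ) (h : Hist (F.P K) j)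
    (W : GaugeField (F.P K) j (Matrix.specialUnitaryGroup (Fin 2) ℂ)) :
    p.T.mainT j h W = (F.scheme ℰp γ).β K * wilsonAction4 (p.UkH j h W) :=
  mainT_towerOfAC_T3_eq 𝔠.lane p.X p.𝔖 j h W

/-- **THE CONSTANTS IN THE ROUTE'S NORMALISATION** (`EcstBook` (i) shape for the successor's `D_of`, `Ecst K j := E_j − E`): for `j ≤ K`,
`E_j − E = −Σ_{i<j} E^{(i)}` — (64) `E_j = Σ_{i=j}^{K−1} E^{(i)}` (the carrier's `Ecst_eq`) and `E = E_0` (`PkgAt.E = Ek Estep K 0`).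
[cite: Balaban1985UV3, (62) p.271 + (64) p.272] -/
theorem AlphaInputsT3AC.PkgAt.Ecst_sub_E_eq {𝔠 : AlphaConsts F.L (suGroupModel 2).N} {hγ1' : γ ≤ (min 𝔠.gamma0 1) ^ 2}
    (p : AlphaInputsT3AC.PkgAt F 𝔠 γ hγ hγ1' K) (j : ℕ) (hj : j ≤ K) :
    p.T.Ecst j - p.E = -∑ i ∈ Finset.range j, p.T.Estep i := by
  have h1 : p.T.Ecst j = ∑ i ∈ Finset.Ico j K, p.T.Estep i := p.T.Ecst_eq j
  have h2 : p.E = ∑ i ∈ Finset.Ico 0 K, p.T.Estep i := rfl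
  rw [h1, h2, Finset.range_eq_Ico, ← Finset.sum_Ico_consecutive _ (Nat.zero_le j) hj]
  ring

end Summit.QuantumFields.YangMills.Theorems

end
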